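import Summits.HodgeConjecture.HodgeConjecture.Theses.HeckePrymWeil
import Literature.AlgebraicGeometry.HodgeTheory.MotivatedClassesAssembly
import Literature.AlgebraicGeometry.HodgeTheory.MotivatedClassesTransport
import Literature.AlgebraicGeometry.HodgeTheory.ComplexConjugationHolds
import Summits.HodgeConjecture.HodgeConjecture.Theorems.HeckePrymWeilSummitOffWeilSectorAndreDeformationLeaves
import Summits.HodgeConjecture.HodgeConjecture.Theorems.HeckePrymWeilSummitOffWeilSectorAndreMotivatedPullback
import Summits.HodgeConjecture.HodgeConjecture.Theorems.HeckePrymWeilSummitOffWeilSectorMotivatedPullbackFst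
import Literature.AlgebraicGeometry.HodgeTheory.RestrictionImageOfCompactification
import Summits.HodgeConjecture.HodgeConjecture.Theorems.HeckePrymWeilSummitOffWeilSectorLefschetzBBelowMiddle
import Summits.HodgeConjecture.HodgeConjecture.Theorems.HeckePrymWeilSummitOffWeilSectorMotivatedAnchorsConstantFamily
import Summits.HodgeConjecture.HodgeConjecture.Theorems.HeckePrymWeilSummitOffWeilSectorCupProductInstances
import Summits.HodgeConjecture.HodgeConjecture.Theorems.HeckePrymWeilSummitOffWeilSectorCupProductAlgebraicDivisor
import Summits.HodgeConjecture.HodgeConjecture.Theorems.HeckePrymWeilSummitOffWeilSectorLefschetzBBelowMiddleHolds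
import Summits.HodgeConjecture.HodgeConjecture.Theorems.HeckePrymWeilSummitOffWeilSectorCupProductOfRoberts
import Literature.AlgebraicGeometry.HodgeTheory.MotivatedClassesLefschetzRange
import Literature.AlgebraicGeometry.HodgeTheory.HardLefschetzNFoldHolds
import Literature.AlgebraicGeometry.HodgeTheory.LefschetzOneOneHolds
import Literature.AlgebraicGeometry.HodgeTheory.MotivatedClassesProofs
import Literature.AlgebraicTopology.SingularHomology.CupProductProofs
import HarnessLib.Audit

/-!
# Line `motivated-anchor-split` — skeleton for crux `HeckePrymWeil.SummitOffWeilSector`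
(item stmt-HodgeConjecture-14374, route route-HodgeConjecture-HeckePrymWeil; crux-strategist /
wall-breaker `planner-cstrat-stmt-HodgeConjecture-14374-p1-0`, 2026-08-17)

Crux (FIXED, the route's typing): `SummitOffWeilSector := WeilSector → HodgeConjecture` — the
Hodge conjecture for every smooth projective complex variety GIVEN the ℚ(√-p) Hodge–Weil sector.
Standing facts (Disproof.lean, cycles 1–2; Negative/ConjectureGrade.lean p76424;
Negative/RouteComplement.lean): `¬crux ↔ WeilSector ∧ ¬HC`; under the route's other items the crux
IS `HodgeConjecture` verbatim (§2b); the antecedent's hypotheses are ANTI-load-bearing (§3: no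
`_false_without_` theorem exists, nothing to honour); every line through the abelian part ends in
the summit-grade stub `HC_ab → HC` (§2c; dead line `IdeatorThreeGen1Sketch`, L0).

This line therefore does what every surviving line on this crux must do (Disproof §2b): it proves
the CONSEQUENT, for all varieties at once, and it does so through the one factorisation of the
Hodge conjecture into two conjectures EACH STRICTLY WEAKER than HC at the present state of
knowledge (both are theorems on abelian varieties, where HC is open) — André's
"HC ⟺ B ∧ (Hodge ⇒ motivated)" (Andre1996Motifs §0.3–0.4, §2.1 remark after Déf. 1) — with the
motivated half put in ANCHOR form, where the transport step is André's UNCONDITIONAL deformation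
theorem 0.5 instead of the conjecture-grade variational Hodge statement of the summit's anchor
routes (AnchorTransport.VariationalHodge, HeckePrymWeil.WeilVariationalHodge):

* `stub_lefschetzStandardB` — Grothendieck's standard conjecture of Lefschetz type for every
  smooth projective complex variety, in André's `*_L`-form on the REAL carriers
  (`HodgeTheory.StandardConjectureBStar`, file `HodgeTheory/MotivatedClasses`); verbatim the
  antecedent of the tree's named fact
  `Andre1996_motivatedClasses_le_algebraicClasses_of_standardConjectureB`. Conjecture-grade
  (known: curves, surfaces, abelian varieties, flag varieties, complete intersections, HK of
  K3^[n]-type). Size: open problem.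
* `stub_motivatedAnchors` — MOTIVATED ANCHOR EXISTENCE (hardest, load-bearing): every rational
  `(p,p)` class `c` on a smooth projective `X` is the fibre value, at a fibre isomorphic to `X`, of a
  global class `A` on the total space of a smooth projective family `f : 𝒳 → S` (projective in
  Hartshorne's sense, `S` reduced, connected, of finite type — exactly the hypotheses of
  `Andre1996_deformation`) whose value at SOME fibre `𝒳_{s₀}` is a MOTIVATED class
  (`HodgeTheory.motivatedClasses`). Weaker than `AnchorTransport.AnchorExistence` (algebraic ⇒
  motivated, tree theorem `algebraicClasses_le_motivatedClasses`; and no fibrewise rational-Hodge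
  bookkeeping is needed) and TRUE on every abelian variety by the constant family (André Thm 0.6.2,
  tree fact `Andre1996_hodgeClasses_abelianVariety_motivated`) — so the whole Weil sector, every
  CM-field Weil class and every exceptional class on abelian varieties cost nothing here; the
  content is the non-abelian-type varieties. Equivalent, given Stub 3, to "every Hodge class is
  motivated" (`Transfer:` in the line card). Conjecture-grade. Size: open problem.
* `stub_andreDeformation` — André's deformation theorem 0.5 in global-class form, the tree's named
  fact `Andre1996_deformation` (a THEOREM in print; the tree reduces it to six classical inputs,
  `MotivatedClassesDeformation.Andre1996_deformation_of_classical_inputs`). Size L.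
* `stub_cupProductAlgebraic` — multiplicativity of algebraic classes on the coniveau carrier,
  the tree's named fact `Voisin2003_cupProduct_algebraicClasses` (Voisin II Prop. 9.20; a THEOREM
  in print; reduced in tree to the moving of supports, `AlgebraicClassesCup`). Size L.

`SummitOffWeilSector_of` takes the stub statements as hypotheses (`type_of% stub_…`; closed,
sorry-free) and concludes the crux BY NAME: given `X`, `c`, Stub 2 gives the family and the
motivated anchor; Stub 3 transports motivatedness to the fibre `𝒳_{s₁} ≅ X`; iso-invariance of
motivated classes (tree theorem `map_mem_motivatedClasses_of_iso`) moves it to `c`; Stub 1 with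
Stub 4 makes motivated classes algebraic (tree theorem
`Andre1996_motivatedClasses_le_algebraicClasses_of_standardConjectureB_holds_of`); the anti-vacuity
conjunct of `HodgeConjectureFor` is the tree theorem `nonempty_hodgeModel_holds`. The sector
hypothesis is not used (Disproof §3: it cannot be load-bearing).

Disproof used: §0 (`Iff.rfl` readback: the goal after `intro` is `HodgeConjecture`), §2b/§2c (why
the line must prove the consequent and must leave abelian varieties: Stub 2 is free exactly on the
abelian part), §3 (no `_false_without_`; sector anti-load-bearing — honoured by not pretending to
use it), §5 (junk vector `IsEmpty HodgeModel` closed by `nonempty_hodgeModel_holds`, used here).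
No landed Negative lemma is instantiated by any stub (ConjectureGrade / RouteComplement concern
`¬crux`). Dead lines avoided: `IdeatorThreeGen1Sketch` / weil-induction-anchors /
weil-lefschetz-saturation all died on the residual `HC_ab → HC`; this line has no abelian-to-all
step — abelian varieties are the EASY case of Stub 2 and Stubs 1, 3, 4 are uniform in `X`.
## Reshape (lead c1, 2026-08-17, after wave 1)

`stub_andreDeformation : Andre1996_deformation` (André Thm. 0.5) is REPLACED by its three open leaves,
using the landed reductions `andreDeformation_of_three_leaves` (p137548: (A0) Mumford's curve lemma and
(A1) Hironaka's compactification discharged by their tree proofs) and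
`andreMotivatedPullback_of_cupProduct_of_mapFst` (p138018: leaf (A5) reduced to Stub 4 and André's
Prop. 2.1 (ii), first inclusion):

* `stub_deligneGlobalInvariantCycles : deligne_globalInvariantCycles` (A2; Deligne, Hodge II 4.1.1 —
  theorem in print; tree named fact, reduced to Voisin II Thm. 4.18 + mixed Hodge structures of a
  pair + Hodge II Cor. 3.2.17);
* `stub_andreSemisimpleLift : Andre1996_exists_motivated_of_motivated_pullback` (A3; André Thm. 0.4 in
  its §5.1 form — theorem in print; tree named fact);
* `stub_motivatedPullbackFst` — André Prop. 2.1 (ii), FIRST inclusion `pr_X^*(A_mot(X)) ⊆ A_mot(X × Z)`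
  (Lemme 1.3.2: the Lefschetz involution of a product polarisation through Künneth) — theorem in
  print; the one input of (A5) the real carriers lack.

Six stubs (≤ stubs_max 7); the composition is unchanged otherwise. Wave-1 supports landed on the
item: p138014 (B: d ≤ 1 in full, middle/top degrees for all d), p138327 (anchors: constant-family
direction C⁺ → Stub 2, converse given Thm. 0.5, algebraic classes, all X of dim ≤ 3, abelian
varieties modulo André Thm. 0.6.2), p137548 + p138018 (this reshape), p137887 (Stub 4: closed range
a = 0 ∨ b = 0 ∨ d ≤ a + b + 1, all bidegrees for d ≤ 3). Status after wave 1: Stubs 1–2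
conjecture-grade (B; Hodge ⇒ motivated off abelian type), Stubs 3a/3b/3c/4 theorem-grade (Hodge II
4.1.1; André 0.4; André Lemme 1.3.2; Chow moving lemma + purity on the coniveau carrier).
## Reshape 2 (lead c1, after wave 2)

* `stub_motivatedPullbackFst` is DROPPED: inside this line it is subsumed by Stubs 1 + 4 (under `B`
  and the multiplicativity, `A_mot = A` and algebraic classes pull back along the flat `fst`; landed
  `motivatedPullbackFst_of_standardConjectureB_of_cupProduct`, p139026). Its unconditional study
  (André Lemme 1.3.2 on the real carriers) continues as supports p139355 / p139647 / p139889: reduced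
  to hard Lefschetz for the exterior-sum polarisation `ζ ⊠ 1 + 1 ⊠ η` on products (missing, size L)
  plus an M-sized above-middle computation.
* `stub_deligneGlobalInvariantCycles` is REPLACED by its one printed leaf
  `stub_voisinRangeRestrict : voisin2003_rangeRestrict_eq_of_compactification` (Voisin II Prop. 4.23
  on the `ℚ`-carriers; tree theorem `deligne_globalInvariantCycles_of_rangeRestrict`, with Voisin II
  Thm. 4.18 PROVED as `deligne1968_invariantClass_fromTotalSpace_holds`).

Five stubs: `stub_lefschetzStandardB` (conjecture-grade: B), `stub_motivatedAnchors`
(conjecture-grade: Hodge ⇒ motivated, anchor form), `stub_voisinRangeRestrict` (theorem: Voisin II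
Prop. 4.23 — Deligne's mixed Hodge structures on an snc compactification, strictness),
`stub_andreSemisimpleLift` (theorem: André Thm. 0.4, semisimplicity of motivated motives via the
Hodge index theorem), `stub_cupProductAlgebraic` (theorem: Voisin II Prop. 9.20 — Chow's moving
lemma + purity on the coniveau carrier; closed in the tree for `a = 0 ∨ b = 0 ∨ d ≤ a + b + 1`).
## Reshape 3 (lead c2, 2026-08-17): every registered stub cut down to its open core

* `stub_lefschetzStandardB` (B in all degrees) is REPLACED by `stub_lefschetzStandardBAboveMiddle` —
  the Lefschetz involutions in the degrees `d < a < 2d` only, i.e. the INVERSE Lefschetz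
  isomorphisms `(L^{a-d})⁻¹ : Hᵃ → H^{2d-a}` (Grothendieck's `B(X)` proper / Kleiman's "`θⁱ` algebraic,
  `i < d`"). The degrees `a ≤ d` (`*_L = Lʲ = (· ∪ ηʲ)`, `ηʲ ∈ Nʲ` under Stub 4) and `a = 2d` are the
  landed `standardConjectureBStar_of_aboveMiddle` (p140910, file
  `Theorems/HeckePrymWeilSummitOffWeilSectorLefschetzBBelowMiddle.lean`, with c1's p138014).
* `stub_motivatedAnchors` is REPLACED by `stub_motivatedAnchorsCore` — the same anchor clause for
  the codimensions `2 ≤ p ≤ n - 2` only (hence `dim X ≥ 4`): the Lefschetz range `p ≤ 1 ∨ n ≤ p + 1`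
  (so every `X` of dimension `≤ 3`) is the landed `motivatedAnchors_of_lefschetzRange` (p138327:
  Lefschetz `(1,1)` + hard Lefschetz + constant family).
* `stub_cupProductAlgebraic` (`Voisin2003_cupProduct_algebraicClasses`, all bidegrees) is SPLIT into
  `stub_cupProductAlgebraicDivisor` — `Nᵃ ∪ N¹ ⊆ Nᵃ⁺¹` on every smooth projective `V` (the divisor
  moves in its linear system: Lelong–Poincaré nondegeneracy + purity for prime divisors, the
  hypothesis `hdiv` of the tree's `cupProduct_mem_algebraicClasses_one_of_forall_primeDivisor'`;
  theorem-grade, size M–L; it alone makes `B` below the middle unconditional) — and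
  `stub_cupProductAlgebraicHigher` — the bidegrees `2 ≤ a`, `2 ≤ b`, `a + b + 2 ≤ d` (Chow's moving
  lemma with purity on the coniveau carrier; theorem-grade, size L). The closed range
  `a = 0 ∨ b = 0 ∨ d ≤ a + b + 1` is c1's `cupProduct_algebraicClasses_of_closedRange` (p137887), the
  bidegree `a = 1` is the divisor stub after graded commutativity; assembled by the sorry-free glue
  `voisin2003_of_pieces` below.

Six stubs (≤ stubs_max 7): two conjecture-grade cores (`…BAboveMiddle` = B; `…AnchorsCore` ⟺ Hodge ⇒
motivated off the Lefschetz range), four theorem-grade (Voisin II Prop. 4.23; André Thm. 0.4;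
Voisin II Prop. 9.20 divisor case; Voisin II Prop. 9.20 / Lemma 9.22 higher bidegrees). The
composition `SummitOffWeilSector_of` is otherwise unchanged and still concludes the crux BY NAME.

Wave 1 of lead c2 (2026-08-17): **Stub 4a `stub_cupProductAlgebraicDivisor` LANDED** (p142851,
`Theorems/HeckePrymWeilSummitOffWeilSectorCupProductAlgebraicDivisor.lean`, with the new Literature
file `HodgeTheory/SupportedClassesPrimeDivisorLocal.lean`, p142289: the classes supported on a prime
divisor die on a Zariski neighbourhood of each of its points — locally factorial + GAGA local
equation + topological Lelong–Poincaré). It is imported below and no longer a stub; five stubs remain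
(`…BAboveMiddle`, `…AnchorsCore` conjecture-grade; `stub_voisinRangeRestrict`,
`stub_andreSemisimpleLift`, `stub_cupProductAlgebraicHigher` theorem-grade).

## Reshape 4 (lead c2, after wave 1): five stubs = two shared conjectures + three named facts

Wave 1 results: Stub 4a LANDED (above); Stub 4b `stub-blocked` on the ONE existing named fact
`Motives.Roberts1972_genericProjection` (Roberts 1972 Main Lemma / Fulton Ex. 11.4.1), with the
reduction kernel-checked and LANDED (`voisin2003_of_roberts1972`,
`Theorems/HeckePrymWeilSummitOffWeilSectorCupProductOfRoberts.lean`: ALL bidegrees of Voisin II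
Prop. 9.20 from that fact, through the cone step of the twin line `HodgeBeyondAnchors/andre_motivated_split`);
Stub 3a `stub-blocked` (first missing input: the Leray residue of the Thom–Gysin sequence of ONE
smooth divisor on `complexBetti`, then Deligne's `∂∂̄` lifts — Hodge II §3.2); Stub 3b `stub-blocked`
(André Thm 0.4 in its §5.1 splitting form + Prop. 2.1 action of motivated correspondences, both absent
on the real carriers). The unconditional by-product: conjecture `B` holds in EVERY degree `a ≤ dim X`
for EVERY smooth projective complex `X` (`standardConjectureBStar_of_le_middle_holds`, p144704), so
`StandardConjectureBStar ↔` its above-middle instances (`standardConjectureBStar_iff_aboveMiddle`).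
The skeleton now reads:

* `stub_lefschetzStandardBAboveMiddle` — conjecture `B` proper (inverse Lefschetz isomorphisms);
  implied VERBATIM by the shared summit-level crux `MotivatedLefschetzSplit.LefschetzStandardB`
  (stmt-HodgeConjecture-17489; glue `stubB_of_lefschetzStandardB`) and equivalent to it for each `Z`
  (`standardConjectureBStar_iff_aboveMiddle`).
* `stub_motivatedAnchorsMiddle` — motivated anchors for the codimensions `2 ≤ p`, `2p ≤ n` ONLY: the
  Lefschetz range is `motivatedAnchors_of_lefschetzRange` (p138327) and the codimensions `2p > n` are
  no longer needed — the composition proves the Hodge conjecture below the middle first and transfers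
  it by hard Lefschetz (`HardLefschetzNFold.mem_algebraicClasses_of_lt_holds`, Kerr–Pearlstein §3.1,
  with the landed divisor case for `L^{2p-n}`). Implied VERBATIM by the shared crux
  `MotivatedLefschetzSplit.HodgeClassesMotivated` (stmt-HodgeConjecture-17488; constant family, glue
  `stubAnchors_of_hodgeClassesMotivated`) and strictly weaker than it (anchors need only be motivated
  at ONE fibre; transport is André Thm 0.5 = Stubs 3a + 3b).
* `stub_voisinRangeRestrict : voisin2003_rangeRestrict_eq_of_compactification` (Voisin II Prop. 4.23).
* `stub_andreSemisimpleLift : Andre1996_exists_motivated_of_motivated_pullback` (André Thm 0.4).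
* `stub_roberts1972 : Roberts1972_genericProjection` (Roberts 1972 / Fulton Ex. 11.4.1) — replaces
  Stub 4b by the named fact it is blocked on.

So the line's whole theorem-grade debt is THREE named Literature facts (each a theorem in print,
each with its consumer kernel-visible), and its conjecture-grade content is implied by the two shared
cruxes 17488/17489 of route `MotivatedLefschetzSplit` (and equals them up to the anchor weakening and
Kleiman's reformulation). `SummitOffWeilSector_of` still concludes the crux BY NAME, sorry-free.
-/

noncomputable section

set_option linter.dupNamespace false

open CategoryTheory AlgebraicGeometry MonoidalCategory CartesianMonoidalCategory
open Literature.AlgebraicGeometry Literature.AlgebraicGeometry.Motives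
  Literature.AlgebraicGeometry.HodgeTheory

namespace Summit.HodgeConjecture.HodgeConjecture.Cruxes.SummitOffWeilSector.MotivatedAnchorSplit

/-! ### The five registered stubs (reshape 4) -/

/-- **Stub 1 (core) — conjecture `B(Z)` ABOVE the middle degree, for every smooth projective
complex variety `Z`**: for a polarisation class `η` of the `d`-fold `Z` and `a + b = 2d` with
`d < a < 2d`, André's Lefschetz involution `*_L : Hᵃ(Z(ℂ); ℂ) → Hᵇ(Z(ℂ); ℂ)` — there the INVERSE of
the hard-Lefschetz isomorphism `L^{a-d} : Hᵇ → Hᵃ` — is induced by an algebraic correspondence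
(`IsAlgebraicCorrespondence`). This is Grothendieck's `B(Z)` proper ("the `Λ`-operation is
algebraic", Bombay 1968 §3; Kleiman 1968 §2: `θⁱ = (L^{d-i})⁻¹` algebraic for `i < d`); the other
degrees of `StandardConjectureBStar` are theorems of the tree granted Stub 4
(`standardConjectureBStar_of_aboveMiddle`, p140910). Known for curves (vacuous), surfaces, abelian
varieties (Lieberman), generalised flag varieties, complete intersections, HK of K3^[n] type; open in
general. [conjecture-grade; open] -/
theorem stub_lefschetzStandardBAboveMiddle :
    ∀ ⦃d : ℕ⦄ ⦃Z : SchemeOver ℂ⦄ ⦃η : complexBetti Z 2⦄ (hZ : IsSmoothProjective d Z)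
      (hη : IsPolarizationClass d Z η) ⦃a b : ℕ⦄ (hab : a + b = 2 * d), d < a → a < 2 * d →
        IsAlgebraicCorrespondence d d Z Z (lefschetzInvolution hη.hasHardLefschetz hab) := by
  sorry

/-- **Stub 2 — MOTIVATED ANCHOR EXISTENCE in the deep middle codimensions `2 ≤ p ≤ n/2` (hardest;
load-bearing).** For every smooth projective complex `X` of dimension `n`, every codimension `p` with
`2 ≤ p` and `2p ≤ n`, and every rational class `c ∈ H²ᵖ(X(ℂ); ℂ)` of Hodge type `(p,p)` there are a
smooth projective family `f : 𝒳 ⟶ S` of relative dimension `n`, projective in Hartshorne's sense (a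
closed immersion into `ℙᴺ × S` over `S`), over a reduced, connected `ℂ`-scheme of finite type `S`, two
complex points `s₁`, `s₀` of `S`, an isomorphism `e : X ≅ 𝒳_{s₁}` and a global class
`A ∈ H²ᵖ(𝒳(ℂ); ℂ)` with `e^*(A|_{𝒳_{s₁}}) = c` and `A|_{𝒳_{s₀}}` MOTIVATED (André 1996 Déf. 1,
`motivatedClasses`). The Lefschetz range `p ≤ 1 ∨ n ≤ p + 1` is a theorem
(`motivatedAnchors_of_lefschetzRange`, p138327) and the codimensions `2p > n` are transferred from
`n - p` by hard Lefschetz inside the composition, so neither is part of the stub. Implied verbatim by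
the shared crux `HodgeClassesMotivated` (stmt-HodgeConjecture-17488) through the constant family
(`stubAnchors_of_hodgeClassesMotivated` below); trivially implied by the Hodge conjecture; TRUE on
abelian varieties (André Thm 0.6.2). Intended anchors: fibres of abelian type, special members of
the Hodge locus (Cattani–Deligne–Kaplan), degenerations. [conjecture-grade; open off abelian type] -/
theorem stub_motivatedAnchorsMiddle :
    ∀ ⦃n : ℕ⦄ ⦃X : SchemeOver ℂ⦄, IsSmoothProjective n X →
      ∀ (p : ℕ), 2 ≤ p → 2 * p ≤ n → ∀ (c : complexBetti X (2 * p)), IsRationalClass c →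
        IsOfHodgeType n X (2 * p) p p c →
        ∃ (𝒳 S : SchemeOver ℂ) (f : 𝒳 ⟶ S) (s₁ s₀ : ComplexPoints S) (e : X ≅ fiberOver f s₁)
          (A : complexBetti 𝒳 (2 * p)),
          IsSmoothProjectiveFamily f n ∧
          (∃ (N : ℕ) (ι : 𝒳 ⟶ projectiveSpace N ℂ ⊗ S),
              IsClosedImmersion ι.left ∧ ι ≫ snd (projectiveSpace N ℂ) S = f) ∧
          IsReduced S.left ∧ ConnectedSpace S.left ∧ LocallyOfFiniteType S.hom ∧
          QuasiCompact S.hom ∧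
          complexBetti.map e.hom (2 * p) (complexBetti.map (fiberι f s₁) (2 * p) A) = c ∧
          complexBetti.map (fiberι f s₀) (2 * p) A ∈ motivatedClasses n (fiberOver f s₀) p := by
  sorry

/-- **Stub 3a — the image of restriction is not changed by a smooth projective compactification**
(Voisin, *Hodge Theory II*, Prop. 4.23, `ℚ`-coefficients: for `i : 𝒳 ⟶ 𝒳̄` an open immersion into a
smooth projective `𝒳̄` and `ι : Y ⟶ 𝒳` a closed immersion from a smooth projective `Y`,
`Im((ι ≫ i)^*) = Im(ι^*)` on `Hᵏ(–(ℂ); ℚ)`; in print: `Hᵏ(U) → Hᵏ(Y)` is a morphism of mixed Hodge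
structures with pure target, `W_k Hᵏ(U) = Im j^*`, strictness). The tree's named fact
`voisin2003_rangeRestrict_eq_of_compactification` (`HodgeTheory/RestrictionImageOfCompactification`),
the ONE printed leaf left under Deligne's théorème de la partie fixe `deligne_globalInvariantCycles`
(= leaf (A2) of `Andre1996_deformation`): tree theorem `deligne_globalInvariantCycles_of_rangeRestrict`
(Voisin II Thm. 4.18 being PROVED, `deligne1968_invariantClass_fromTotalSpace_holds`).
[theorem in print; size L: Deligne's mixed Hodge structure of a smooth variety] -/
theorem stub_voisinRangeRestrict : voisin2003_rangeRestrict_eq_of_compactification := by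
  sorry

/-- **Stub 3b — André's semisimple lift** (Andre1996Motifs Thm. 0.4 as used in §5.1, p. 25: for
`j : X ⟶ X̄` of smooth projective varieties, a class of `X̄` whose restriction to `X` is motivated has
the same restriction as a MOTIVATED class of `X̄` — semisimplicity of the category of motivated
motives). The tree's named fact `Andre1996_exists_motivated_of_motivated_pullback`
(`HodgeTheory/MotivatedClassesDeformationLeaves`; leaf (A3) of `Andre1996_deformation`).
[theorem in print; size L–XL: André §2–§4 on the real carriers] -/
theorem stub_andreSemisimpleLift : Andre1996_exists_motivated_of_motivated_pullback := by
  sorry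

/-- **Stub 5 — Roberts' generic projection cone** (J. Roberts, *Chow's moving lemma* (1972), Main
Lemma and §2; W. Fulton, *Intersection Theory* §11.4 Example 11.4.1 (a)–(b)): the tree's named fact
`Motives.Roberts1972_genericProjection` (file `Motives/GenericProjectionCone`) — for `Z` meeting `W`
improperly on a smooth projective `n`-fold, a finite `φ : X ⟶ ℙⁿ`, étale on an open set meeting `Z`,
and a residual closed `Z' ⊉ Z` of codimension `≥ l` with `φ⁻¹(φ Z) ⊆ Z ∪ Z'` and
`codim (Z' ∩ W) > codim (Z ∩ W)`. It is the ONE input under which the tree proves the multiplicativity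
`Voisin2003_cupProduct_algebraicClasses` in all bidegrees (`voisin2003_of_roberts1972`, landed
`Theorems/HeckePrymWeilSummitOffWeilSectorCupProductOfRoberts.lean`; wave-1 reply `stub-blocked:
Roberts1972_genericProjection` for the former Stub 4b). Shared verbatim with the twin line's
`stub_genericProjection` (crux stmt-HodgeConjecture-14054) and with the support item
stmt-HodgeConjecture-17490 (`DiagonalPullbackAlgebraic`) of route `MotivatedLefschetzSplit`.
[theorem in print; size XL: generic linear projections, joins, Roberts' excess count] -/
theorem stub_roberts1972 : Roberts1972_genericProjection := by
  sorry

/-! ### Sorry-free glue: the shared cruxes 17489 / 17488 imply Stubs 1 / 2 -/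

/-- **The shared crux `LefschetzStandardB` (stmt-HodgeConjecture-17489, verbatim) implies Stub 1**
(specialisation to the degrees `d < a < 2d`; the converse for each `Z` is
`standardConjectureBStar_iff_aboveMiddle`, p144704). [cite: Grothendieck1968, §3 p. 196 (B(X))] -/
theorem stubB_of_lefschetzStandardB
    (hB : ∀ (d : ℕ) (Z : SchemeOver ℂ) (η : complexBetti Z 2), IsSmoothProjective d Z →
      StandardConjectureBStar d Z η) :
    type_of% stub_lefschetzStandardBAboveMiddle :=
  fun _ Z η hZ hη a b hab _ _ ↦ hB _ Z η hZ hη a b hab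

/-- **The shared crux `HodgeClassesMotivated` (stmt-HodgeConjecture-17488, verbatim) implies Stub 2**:
a motivated class has motivated anchors by the constant family
(`motivatedAnchors_of_mem_motivatedClasses`, p138327). [cite: Andre1996Motifs, §2.1 Déf. 1 (p. 14)] -/
theorem stubAnchors_of_hodgeClassesMotivated
    (hHM : ∀ ⦃n : ℕ⦄ ⦃X : SchemeOver ℂ⦄, IsSmoothProjective n X → ∀ p : ℕ, 2 ≤ p → 2 * p ≤ n →
      ∀ c : complexBetti X (2 * p), IsRationalClass c → IsOfHodgeType n X (2 * p) p p c →
        c ∈ motivatedClasses n X p) :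
    type_of% stub_motivatedAnchorsMiddle :=
  fun _ _ hX p hp2 h2p c hc hpp ↦
    Summit.HodgeConjecture.HodgeConjecture.Theorems.motivatedAnchors_of_mem_motivatedClasses hX p c
      (hHM hX p hp2 h2p c hc hpp)

/-! ### The composition (concludes the crux BY NAME; sorry-free glue) -/

/-- **`SummitOffWeilSector` from the five stubs.** The sector hypothesis is discarded (it cannot be
load-bearing, Disproof §3). First the multiplicativity `Voisin2003_cupProduct_algebraicClasses` is
obtained from Stub 5 (`voisin2003_of_roberts1972`) and conjecture `B` in all degrees from Stub 1
(`standardConjectureBStar_of_aboveMiddle_holds`, p144704 — unconditional in the degrees `a ≤ d`). André's deformation theorem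
`Andre1996_deformation` is then assembled: leaf (A2) from Stub 3a
(`deligne_globalInvariantCycles_of_rangeRestrict`), leaf (A3) = Stub 3b, leaf (A5) from `B` + the
multiplicativity (`motivatedPullbackFst_of_standardConjectureB_of_cupProduct`, then
`andreMotivatedPullback_of_cupProduct_of_mapFst`), by `andreDeformation_of_three_leaves` ((A0) Mumford
and (A1) Hironaka are tree theorems). Then for `X` smooth projective and a rational `(p,p)` class
`c`: for `2p ≤ n`, either `p ≤ 1` (Lefschetz `(1,1)`, `mem_algebraicClasses_of_lefschetzRange` with the
proved `lefschetzOneOne_rational_holds` / `nonempty_hardLefschetzNFold_holds`) or Stub 2 gives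
`(f, s₁, s₀, e, A)`, deformation carries motivatedness from `𝒳_{s₀}` to `𝒳_{s₁}`,
`map_mem_motivatedClasses_of_iso` carries it across `e` to `c`, and `B` + the multiplicativity make
motivated classes algebraic (`Andre1996_motivatedClasses_le_algebraicClasses_of_standardConjectureB_holds_of`);
for `2p > n` the class comes from codimension `n - p` by hard Lefschetz
(`HardLefschetzNFold.mem_algebraicClasses_of_lt_holds`, unconditional). Hodge models exist by
`nonempty_hodgeModel_holds`. -/
theorem SummitOffWeilSector_of
    (hBup : type_of% stub_lefschetzStandardBAboveMiddle) (hAn : type_of% stub_motivatedAnchorsMiddle)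
    (hVR : type_of% stub_voisinRangeRestrict) (h04 : type_of% stub_andreSemisimpleLift)
    (hR : type_of% stub_roberts1972) :
    Summit.HodgeConjecture.HodgeConjecture.Theses.HeckePrymWeil.SummitOffWeilSector := by
  have hcup : Voisin2003_cupProduct_algebraicClasses :=
    Summit.HodgeConjecture.HodgeConjecture.Theorems.voisin2003_of_roberts1972 hR
  have hB : ∀ (d : ℕ) (Z : SchemeOver ℂ) (η : complexBetti Z 2), IsSmoothProjective d Z →
      StandardConjectureBStar d Z η :=
    Summit.HodgeConjecture.HodgeConjecture.Theorems.standardConjectureBStar_of_aboveMiddle_holds hBup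
  have hDef : Andre1996_deformation :=
    Summit.HodgeConjecture.HodgeConjecture.Theorems.andreDeformation_of_three_leaves
      (deligne_globalInvariantCycles_of_rangeRestrict hVR) h04
      (Summit.HodgeConjecture.HodgeConjecture.Theorems.andreMotivatedPullback_of_cupProduct_of_mapFst
        hcup
        (Summit.HodgeConjecture.HodgeConjecture.Theorems.motivatedPullbackFst_of_standardConjectureB_of_cupProduct
          hcup hB))
  intro _hW n X hX
  refine ⟨(nonempty_hodgeModel_holds (n := n) (X := X)).nonempty hX, fun p c hc hpp => ?_⟩
  -- the Hodge conjecture on `X` in the codimensions `2p ≤ n`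
  have low : ∀ q : ℕ, 2 * q ≤ n → ∀ c' : complexBetti X (2 * q), IsRationalClass c' →
      IsOfHodgeType n X (2 * q) q q c' → c' ∈ algebraicClasses X q := by
    intro q hq c' hc' hqq
    by_cases hq1 : q ≤ 1
    · exact mem_algebraicClasses_of_lefschetzRange lefschetzOneOne_rational_holds
        (nonempty_hardLefschetzNFold_holds n X) hX (Or.inl hq1) c' hc' hqq
    obtain ⟨𝒳, S, f, s₁, s₀, e, A, hf, hproj, hred, hconn, hft, hqc, hAc, hs₀⟩ :=
      hAn hX q (by omega) hq c' hc' hqq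
    have h₁ : complexBetti.map (fiberι f s₁) (2 * q) A ∈ motivatedClasses n (fiberOver f s₁) q :=
      hDef f hf hproj hred hconn hft hqc q A s₀ hs₀ s₁
    have h₂ : c' ∈ motivatedClasses n X q := by
      rw [← hAc]
      exact map_mem_motivatedClasses_of_iso (hf.isSmoothProjective s₁) hX e h₁
    exact Andre1996_motivatedClasses_le_algebraicClasses_of_standardConjectureB_holds_of hcup hB hX q h₂
  -- above the middle by hard Lefschetz (Kerr–Pearlstein §3.1), unconditionally
  by_cases h2 : 2 * p ≤ n
  · exact low p h2 c hc hpp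
  · exact HardLefschetzNFold.mem_algebraicClasses_of_lt_holds hX (by omega)
      (fun c' hc' hpp' ↦ low (n - p) (by omega) c' hc' hpp') c hc hpp

/-- The crux from the stubs as they stand (depends on their `sorry`s; shows the composition closes). -/
theorem SummitOffWeilSector_of_stubs :
    Summit.HodgeConjecture.HodgeConjecture.Theses.HeckePrymWeil.SummitOffWeilSector :=
  SummitOffWeilSector_of stub_lefschetzStandardBAboveMiddle stub_motivatedAnchorsMiddle
    stub_voisinRangeRestrict stub_andreSemisimpleLift stub_roberts1972

/-- Alias in the skeleton checker's `<Crux>_proof` spelling. -/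
theorem SummitOffWeilSector_proof :
    Summit.HodgeConjecture.HodgeConjecture.Theses.HeckePrymWeil.SummitOffWeilSector :=
  SummitOffWeilSector_of_stubs

end Summit.HodgeConjecture.HodgeConjecture.Cruxes.SummitOffWeilSector.MotivatedAnchorSplit

end
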